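import Summits.Ventures.PercRepro.OrbitK

/-!
# PercRepro — the arithmetic lemmas behind the regime A / B′ inequalities of the `q = 3` counting programme (p2, gen 11)

Night-1's counting route to C-025 at `q = 3` (`proofs/NIGHT-1-C025-induction.md` §12–§13) reduces the core case to two
purely arithmetic inequalities in `n = p + d` (see `CoreRegimes.lean`, where they are stated as `RegimeA` / `RegimeB` and
proved for every `p ≥ 201` — THEOREM R3 of `proofs/P2-R3.md`). This file holds the seven elementary lemmas of that proof,
all over `ℕ` / `ℚ` with binomial coefficients only (no matroid):

* `phiK_three_mul_choose`, `phiK_three_mul_choose_le`: `Φ(p,3)·C(p+3,3) = Σ_{3<u<p} C(p+3,u) ≤ 2^{p+3}` (Lemma 1);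
* `six_mul_choose_three`: `6·C(m+2,3) = (m+2)(m+1)m`; `six_mul_choose_three_le`: `6·C(n,3) ≤ n³`;
  `pow_three_le_six_mul_choose`: `(p+1)³ ≤ 6·C(p+3,3)` (Lemma 2); `choose_three_ge_thirty_sq`: `30·n² ≤ C(n,3)` for
  `n ≥ 183` (Lemma 3);
* `ten_thousand_pow_nine_le_two_pow`: `10⁴·n⁹ ≤ 2ⁿ` for `n ≥ 207`; `sum_range_choose_le_of_le_nine`:
  `Σ_{j≤d} C(n,j) ≤ 10·n⁹` for `d ≤ 9` (Lemma 4);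
* `two_pow_le_two_mul_sum_choose`: `2ⁿ ≤ 2·Σ_{i<m} C(n,i)` for `n + 1 ≤ 2m`; `sum_range_choose_mono`;
  `sum_range_choose_add_sum_range_choose`: `Σ_{j≤d} C(p+d,j) + Σ_{i<p} C(p+d,i) = 2^{p+d}` (Lemma 5);
* `three_mul_choose_le_choose_succ`: `3·C(n,k) ≤ C(n,k+1)` for `n ≥ 4k+3`; `three_pow_mul_choose_three_le`:
  `3^j·C(n,3) ≤ C(n,j+3)` for `j + 4 ≤ p`, `4p ≤ n + 1` (Lemma 6);
* `two_pow_add_ten_le_three_pow`, `two_pow_le_three_pow`: `2^{k+10} ≤ 3^k` for `k ≥ 197`; `eighty_mul_cube_le_four_pow`: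
  `80·(4p+2)³ ≤ 4^p` for `p ≥ 201` (Lemma 7).
-/

namespace PercRepro
namespace CoreRegimes

open Finset

/-! ### Lemma 1: `Φ(p,3)·C(p+3,3) ≤ 2^{p+3}` -/

/-- `Φ(p,3)·C(p+3,3) = Σ_{3<u<p} C(p+3,u)` (the definition of `phiK`, with `C(p+3,p) = C(p+3,3)`). -/
theorem phiK_three_mul_choose (p : ℕ) :
    phiK p 3 * (Nat.choose (p + 3) 3 : ℚ) = ∑ u ∈ Ioo 3 p, (Nat.choose (p + 3) u : ℚ) := by
  unfold phiK
  have h3 : Nat.choose (p + 3) p = Nat.choose (p + 3) 3 := Nat.choose_symm_add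
  have hpos : (0 : ℚ) < (Nat.choose (p + 3) 3 : ℚ) := by
    exact_mod_cast Nat.choose_pos (by omega)
  rw [h3, div_mul_cancel₀ _ hpos.ne']

/-- `Φ(p,3)·C(p+3,3) ≤ 2^{p+3}`. -/
theorem phiK_three_mul_choose_le (p : ℕ) :
    phiK p 3 * (Nat.choose (p + 3) 3 : ℚ) ≤ (2 : ℚ) ^ (p + 3) := by
  rw [phiK_three_mul_choose]
  have hsub : Ioo 3 p ⊆ range (p + 3 + 1) := by
    intro u hu
    simp only [mem_Ioo] at hu
    simp only [mem_range]
    omega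
  calc (∑ u ∈ Ioo 3 p, (Nat.choose (p + 3) u : ℚ))
      ≤ ∑ u ∈ range (p + 3 + 1), (Nat.choose (p + 3) u : ℚ) :=
        sum_le_sum_of_subset_of_nonneg hsub (fun _ _ _ => by positivity)
    _ = (2 : ℚ) ^ (p + 3) := by exact_mod_cast Nat.sum_range_choose (p + 3)

/-- `0 ≤ Φ(p,3)`. -/
theorem phiK_three_nonneg (p : ℕ) : 0 ≤ phiK p 3 := by
  unfold phiK
  positivity

/-! ### Lemma 2 / 3: `6·C(n,3) = n(n−1)(n−2)` and its consequences -/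

/-- `6·C(m+2, 3) = (m+2)(m+1)m`. -/
theorem six_mul_choose_three (m : ℕ) : 6 * Nat.choose (m + 2) 3 = (m + 2) * (m + 1) * m := by
  have h2 : Nat.choose (m + 2) 2 * 2 = (m + 2) * (m + 1) := by
    have := Nat.choose_succ_right_eq (m + 2) 1
    rw [Nat.choose_one_right, show m + 2 - 1 = m + 1 by omega] at this
    simpa using this
  have h3 : Nat.choose (m + 2) 3 * 3 = Nat.choose (m + 2) 2 * m := by
    have := Nat.choose_succ_right_eq (m + 2) 2
    rw [show m + 2 - 2 = m by omega] at this
    simpa using this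
  calc 6 * Nat.choose (m + 2) 3 = 2 * (Nat.choose (m + 2) 3 * 3) := by ring
    _ = 2 * (Nat.choose (m + 2) 2 * m) := by rw [h3]
    _ = (Nat.choose (m + 2) 2 * 2) * m := by ring
    _ = ((m + 2) * (m + 1)) * m := by rw [h2]

/-- `6·C(n,3) ≤ n³`. -/
theorem six_mul_choose_three_le (n : ℕ) : 6 * Nat.choose n 3 ≤ n ^ 3 := by
  rcases Nat.lt_or_ge n 2 with h | h
  · interval_cases n <;> simp [Nat.choose_eq_zero_of_lt]
  · obtain ⟨m, rfl⟩ : ∃ m, n = m + 2 := ⟨n - 2, by omega⟩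
    rw [six_mul_choose_three]
    nlinarith

/-- `(p+1)³ ≤ 6·C(p+3,3)`. -/
theorem pow_three_le_six_mul_choose (p : ℕ) : (p + 1) ^ 3 ≤ 6 * Nat.choose (p + 3) 3 := by
  have := six_mul_choose_three (p + 1)
  rw [show p + 1 + 2 = p + 3 by omega] at this
  rw [this]
  nlinarith

/-- `30·n² ≤ C(n,3)` for `n ≥ 183`. -/
theorem choose_three_ge_thirty_sq (n : ℕ) (hn : 183 ≤ n) : 30 * n ^ 2 ≤ Nat.choose n 3 := by
  obtain ⟨m, rfl⟩ : ∃ m, n = m + 2 := ⟨n - 2, by omega⟩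
  have h := six_mul_choose_three m
  have hm : 181 ≤ m := by omega
  nlinarith [h, hm]

/-! ### Lemma 4: `10⁴·n⁹ ≤ 2ⁿ` for `n ≥ 207` -/

/-- `10⁴·n⁹ ≤ 2ⁿ` for every `n ≥ 207`. -/
theorem ten_thousand_pow_nine_le_two_pow (n : ℕ) (hn : 207 ≤ n) : 10000 * n ^ 9 ≤ 2 ^ n := by
  induction n, hn using Nat.le_induction with
  | base => norm_num
  | succ k hk ih =>
    have h1 : 207 * (k + 1) ≤ 208 * k := by omega
    have h2 : (207 * (k + 1)) ^ 9 ≤ (208 * k) ^ 9 := Nat.pow_le_pow_left h1 9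
    have h3 : 208 ^ 9 ≤ 2 * 207 ^ 9 := by norm_num
    have h4 : (k + 1) ^ 9 ≤ 2 * k ^ 9 := by
      have : 207 ^ 9 * (k + 1) ^ 9 ≤ 2 * 207 ^ 9 * k ^ 9 := by
        calc 207 ^ 9 * (k + 1) ^ 9 = (207 * (k + 1)) ^ 9 := by ring
          _ ≤ (208 * k) ^ 9 := h2
          _ = 208 ^ 9 * k ^ 9 := by ring
          _ ≤ 2 * 207 ^ 9 * k ^ 9 := by nlinarith [h3, Nat.zero_le (k ^ 9)]
      have hpos : 0 < 207 ^ 9 := by positivity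
      nlinarith [this, hpos]
    calc 10000 * (k + 1) ^ 9 ≤ 10000 * (2 * k ^ 9) := by gcongr
      _ = 2 * (10000 * k ^ 9) := by ring
      _ ≤ 2 * 2 ^ k := by gcongr
      _ = 2 ^ (k + 1) := by ring

/-- The tail `Σ_{j≤d} C(n,j)` for `d ≤ 9`: at most `10·n⁹`. -/
theorem sum_range_choose_le_of_le_nine (n d : ℕ) (hd : d ≤ 9) (hn : 1 ≤ n) :
    ∑ j ∈ range (d + 1), Nat.choose n j ≤ 10 * n ^ 9 := by
  have hsub : range (d + 1) ⊆ range 10 := range_subset_range.2 (by omega)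
  calc ∑ j ∈ range (d + 1), Nat.choose n j
      ≤ ∑ j ∈ range 10, Nat.choose n j := sum_le_sum_of_subset_of_nonneg hsub (fun _ _ _ => Nat.zero_le _)
    _ ≤ ∑ j ∈ range 10, n ^ 9 := by
        apply sum_le_sum
        intro j hj
        simp only [mem_range] at hj
        calc Nat.choose n j ≤ n ^ j := Nat.choose_le_pow n j
          _ ≤ n ^ 9 := Nat.pow_le_pow_right hn (by omega)
    _ = 10 * n ^ 9 := by simp

/-! ### Lemma 5: half sums, monotonicity, and the complement identity -/

/-- `2ⁿ ≤ 2·Σ_{i<m} C(n,i)` whenever `n ≤ 2m − 1` (i.e. `n + 1 ≤ 2m`). -/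
theorem two_pow_le_two_mul_sum_choose (n m : ℕ) (h : n + 1 ≤ 2 * m) :
    2 ^ n ≤ 2 * ∑ i ∈ range m, Nat.choose n i := by
  rcases Nat.lt_or_ge n m with hnm | hmn
  · -- every term of `Σ_{i ≤ n}` is present
    have hsub : range (n + 1) ⊆ range m := range_subset_range.2 hnm
    have : ∑ i ∈ range (n + 1), Nat.choose n i ≤ ∑ i ∈ range m, Nat.choose n i :=
      sum_le_sum_of_subset_of_nonneg hsub (fun _ _ _ => Nat.zero_le _)
    rw [Nat.sum_range_choose] at this
    omega
  · have hsplit := sum_range_add_sum_Ico (fun i => Nat.choose n i) (show m ≤ n + 1 by omega)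
    rw [Nat.sum_range_choose] at hsplit
    -- reflect the upper part
    have hrefl : ∑ i ∈ Ico m (n + 1), Nat.choose n i = ∑ j ∈ range (n + 1 - m), Nat.choose n j := by
      have h1 : ∑ i ∈ Ico m (n + 1), Nat.choose n i = ∑ i ∈ Ico m (n + 1), Nat.choose n (n - i) := by
        apply sum_congr rfl
        intro i hi
        simp only [mem_Ico] at hi
        exact (Nat.choose_symm (by omega)).symm
      rw [h1, sum_Ico_reflect (fun j => Nat.choose n j) m (le_refl (n + 1))]
      simp
    have hle : ∑ j ∈ range (n + 1 - m), Nat.choose n j ≤ ∑ i ∈ range m, Nat.choose n i :=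
      sum_le_sum_of_subset_of_nonneg (range_subset_range.2 (by omega)) (fun _ _ _ => Nat.zero_le _)
    omega

/-- `Σ_{i<m} C(n,i)` is monotone in `n`. -/
theorem sum_range_choose_mono (m n n' : ℕ) (h : n ≤ n') :
    ∑ i ∈ range m, Nat.choose n i ≤ ∑ i ∈ range m, Nat.choose n' i :=
  sum_le_sum (fun i _ => Nat.choose_le_choose i h)

/-- The complement identity `Σ_{j≤d} C(p+d, j) + Σ_{i<p} C(p+d, i) = 2^{p+d}`. -/
theorem sum_range_choose_add_sum_range_choose (p d : ℕ) :
    ∑ j ∈ range (d + 1), Nat.choose (p + d) j + ∑ i ∈ range p, Nat.choose (p + d) i = 2 ^ (p + d) := by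
  have hsplit := sum_range_add_sum_Ico (fun i => Nat.choose (p + d) i) (show d + 1 ≤ p + d + 1 by omega)
  rw [Nat.sum_range_choose] at hsplit
  have hrefl : ∑ i ∈ Ico (d + 1) (p + d + 1), Nat.choose (p + d) i = ∑ j ∈ range p, Nat.choose (p + d) j := by
    have h1 : ∑ i ∈ Ico (d + 1) (p + d + 1), Nat.choose (p + d) i
        = ∑ i ∈ Ico (d + 1) (p + d + 1), Nat.choose (p + d) (p + d - i) := by
      apply sum_congr rfl
      intro i hi
      simp only [mem_Ico] at hi
      exact (Nat.choose_symm (by omega)).symm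
    rw [h1, sum_Ico_reflect (fun j => Nat.choose (p + d) j) (d + 1) (le_refl (p + d + 1))]
    have : p + d + 1 - (p + d + 1) = 0 := by omega
    have h2 : p + d + 1 - (d + 1) = p := by omega
    rw [this, h2, Finset.range_eq_Ico]
  omega

/-! ### Lemma 6: ratio growth `3·C(n,k) ≤ C(n,k+1)` for `n ≥ 4k + 3` -/

/-- `3·C(n,k) ≤ C(n,k+1)` whenever `4k + 3 ≤ n`. -/
theorem three_mul_choose_le_choose_succ (n k : ℕ) (h : 4 * k + 3 ≤ n) :
    3 * Nat.choose n k ≤ Nat.choose n (k + 1) := by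
  have h1 := Nat.choose_succ_right_eq n k
  have h2 : 3 * (k + 1) ≤ n - k := by omega
  have h3 : Nat.choose n k * (3 * (k + 1)) ≤ Nat.choose n (k + 1) * (k + 1) := by
    rw [h1]
    exact Nat.mul_le_mul_left _ h2
  have h4 : (3 * Nat.choose n k) * (k + 1) ≤ Nat.choose n (k + 1) * (k + 1) := by
    calc (3 * Nat.choose n k) * (k + 1) = Nat.choose n k * (3 * (k + 1)) := by ring
      _ ≤ _ := h3
  exact Nat.le_of_mul_le_mul_right h4 (by omega)

/-- `3^j·C(n,3) ≤ C(n, j+3)` for every `j` with `j + 4 ≤ p`, when `4p ≤ n + 1`. -/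
theorem three_pow_mul_choose_three_le (n p : ℕ) (hn : 4 * p ≤ n + 1) :
    ∀ j, j + 4 ≤ p → 3 ^ j * Nat.choose n 3 ≤ Nat.choose n (j + 3) := by
  intro j
  induction j with
  | zero => intro _; simp
  | succ j ih =>
    intro hj
    have h1 := ih (by omega)
    have h2 : 3 * Nat.choose n (j + 3) ≤ Nat.choose n (j + 3 + 1) :=
      three_mul_choose_le_choose_succ n (j + 3) (by omega)
    calc 3 ^ (j + 1) * Nat.choose n 3 = 3 * (3 ^ j * Nat.choose n 3) := by ring
      _ ≤ 3 * Nat.choose n (j + 3) := by gcongr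
      _ ≤ Nat.choose n (j + 3 + 1) := h2
      _ = Nat.choose n (j + 1 + 3) := by rw [show j + 3 + 1 = j + 1 + 3 by omega]

/-! ### Lemma 7: the exponential comparisons -/

/-- `2^{k+10} ≤ 3^k` for `k ≥ 197`. -/
theorem two_pow_add_ten_le_three_pow (k : ℕ) (hk : 197 ≤ k) : 2 ^ (k + 10) ≤ 3 ^ k := by
  induction k, hk using Nat.le_induction with
  | base => norm_num
  | succ k _ ih =>
    calc 2 ^ (k + 1 + 10) = 2 * 2 ^ (k + 10) := by ring
      _ ≤ 2 * 3 ^ k := by gcongr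
      _ ≤ 3 * 3 ^ k := by gcongr; norm_num
      _ = 3 ^ (k + 1) := by ring

/-- `2^{p+6} ≤ 3^{p−4}` for `p ≥ 201` (stated without subtraction: `p = k + 4`). -/
theorem two_pow_le_three_pow (k : ℕ) (hk : 197 ≤ k) : 2 ^ (k + 4 + 6) ≤ 3 ^ k := by
  rw [show k + 4 + 6 = k + 10 by omega]
  exact two_pow_add_ten_le_three_pow k hk

/-- `80·(4p+2)³ ≤ 4^p` for `p ≥ 201`. -/
theorem eighty_mul_cube_le_four_pow (p : ℕ) (hp : 201 ≤ p) : 80 * (4 * p + 2) ^ 3 ≤ 4 ^ p := by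
  induction p, hp using Nat.le_induction with
  | base => norm_num
  | succ k hk ih =>
    have h1 : (4 * (k + 1) + 2) ^ 3 ≤ 4 * (4 * k + 2) ^ 3 := by
      set t := 4 * k + 2 with ht_def
      have ht : 806 ≤ t := by omega
      have hsq : 806 * t ^ 2 ≤ t ^ 3 := by
        calc 806 * t ^ 2 ≤ t * t ^ 2 := Nat.mul_le_mul_right _ ht
          _ = t ^ 3 := by ring
      have hlin : t ≤ t ^ 2 := by nlinarith [ht]
      have hone : 1 ≤ t ^ 2 := by nlinarith [ht]
      have h4 : 4 * (k + 1) + 2 = t + 4 := by omega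
      rw [h4]
      nlinarith [hsq, hlin, hone]
    calc 80 * (4 * (k + 1) + 2) ^ 3 ≤ 80 * (4 * (4 * k + 2) ^ 3) := by gcongr
      _ = 4 * (80 * (4 * k + 2) ^ 3) := by ring
      _ ≤ 4 * 4 ^ k := by gcongr
      _ = 4 ^ (k + 1) := by ring


end CoreRegimes
end PercRepro
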